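import Literature.Probability.RandomPlanarGeometry.CaratheodoryHalfPlane
import Literature.Probability.RandomPlanarGeometry.JordanIndexOne

/-!
# Welding continuity, part C: three-point normalised half-plane uniformisers from a disc chart

Support file for item `stmt-CriticalPhenomena-4509` (`SAWWeldingIdentification.WeldingContinuity`).

Given a conformal map `f : 𝔻 → D` onto a Jordan domain with Carathéodory extension `F`
(continuous on `𝔻̄`, `= f` on `𝔻`), a unit complex number `η` and reals `u`, `c > 0`, the map

`φ = f ∘ (η ·) ∘ cayley ∘ (z ↦ c z + u) : ℍₒ → D`

is a conformal equivalence with `φ → F (η · cayleyFun (c x + u))` within `ℍₒ` at every point `x`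
of the closed half-plane and `φ → F η` at infinity (`exists_threePointMap`). With `η = ζ_b`,
`cayleyFun u = ζ_b⁻¹ ζ_a`, `cayleyFun (u + c s) = ζ_b⁻¹ ζ_c` (`s = ±1`) this is the normalised
uniformiser `(ℍₒ; 0, ∞, s) → (D; F ζ_a, F ζ_b, F ζ_c)` of the welding configurations, with an
explicit boundary extension. This file is the `Cayley ∘ affine` bookkeeping of
`MarkedDomain.exists_isChordalUniformizing_of_closedBall` with one more real parameter.

References: Ahlfors (1979), Ch. 3 §3, Ch. 6 §1.1; Pommerenke (1992), §1.2, Thm. 2.6.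
-/

noncomputable section

open Set Filter Metric Complex
open scoped Topology
open UpperHalfPlane (upperHalfPlaneSet)
open Literature.Probability.RandomPlanarGeometry Literature.Topology.PlaneTopology

namespace Summit.CriticalPhenomena.SAWScalingLimit.Theorems.WeldingContinuity

/-- The real affine map `z ↦ c z + u` (`c > 0`, `u ∈ ℝ`) maps `𝓝[ℍₒ] x` to `𝓝[ℍₒ] (c x + u)`.
[folklore] -/
theorem tendsto_affine_nhdsWithin {c : ℝ} (hc : 0 < c) (u : ℝ) (x : ℂ) :
    Tendsto (fun z : ℂ => (c : ℂ) * z + u) (𝓝[upperHalfPlaneSet] x)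
      (𝓝[upperHalfPlaneSet] ((c : ℂ) * x + u)) := by
  have hcont : Continuous fun z : ℂ => (c : ℂ) * z + u := by fun_prop
  refine (hcont.continuousWithinAt (s := upperHalfPlaneSet) (x := x)).tendsto_nhdsWithin ?_
  intro z hz
  change 0 < ((c : ℂ) * z + u).im
  have hz' : 0 < z.im := hz
  simp only [add_im, mul_im, ofReal_re, ofReal_im, zero_mul, add_zero]
  exact mul_pos hc hz'

/-- The real affine map `z ↦ c z + u` (`c > 0`) preserves the filter "at infinity within `ℍₒ`".
[folklore] -/
theorem tendsto_affine_cocompact_inf {c : ℝ} (hc : 0 < c) (u : ℝ) :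
    Tendsto (fun z : ℂ => (c : ℂ) * z + u) (cocompact ℂ ⊓ 𝓟 upperHalfPlaneSet)
      (cocompact ℂ ⊓ 𝓟 upperHalfPlaneSet) := by
  have h1 : Tendsto (fun z : ℂ => c • z) (cocompact ℂ) (cocompact ℂ) := by
    have := (Homeomorph.smulOfNeZero c hc.ne' : ℂ ≃ₜ ℂ).map_cocompact
    exact this.le
  have h1' : Tendsto (fun z : ℂ => (c : ℂ) * z) (cocompact ℂ) (cocompact ℂ) := by
    refine h1.congr fun z => ?_
    rw [Complex.real_smul]
  have h2 : Tendsto (fun z : ℂ => (c : ℂ) * z) (cocompact ℂ ⊓ 𝓟 upperHalfPlaneSet)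
      (cocompact ℂ ⊓ 𝓟 upperHalfPlaneSet) := by
    refine h1'.inf (tendsto_principal_principal.2 fun z hz => ?_)
    change 0 < ((c : ℂ) * z).im
    have hz' : 0 < z.im := hz
    simp only [mul_im, ofReal_re, ofReal_im, zero_mul, add_zero]
    exact mul_pos hc hz'
  exact (tendsto_add_real_cocompact_inf u).comp h2

/-- **Three-point uniformisers from a disc chart.** Let `f : 𝔻 → D` be a conformal equivalence
onto a Jordan domain, `F` a continuous extension of `f` to the closed disc, `η` a unit complex
number, `u ∈ ℝ` and `c > 0`. Then there is a conformal equivalence `φ : ℍₒ → D`, namely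
`φ z = f (η · cayleyFun (c z + u))`, such that `φ → F (η · cayleyFun (c x + u))` within `ℍₒ` at
every point `x` with `im x ≥ 0`, and `φ → F η` at infinity within `ℍₒ`.
[cite: AhlforsCA1979, Ch. 6 §1.1 Thm. 1] -/
theorem exists_threePointMap (D : JordanDomain) (f : ConformalEquiv (ball (0 : ℂ) 1) D.carrier)
    {F : ℂ → ℂ} (hFc : ContinuousOn F (closedBall 0 1)) (hFeq : EqOn F f (ball 0 1))
    {η : ℂ} (hη : ‖η‖ = 1) (u : ℝ) {c : ℝ} (hc : 0 < c) :
    ∃ φ : ConformalEquiv upperHalfPlaneSet D.carrier,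
      (∀ z ∈ upperHalfPlaneSet, φ z = f (η * cayleyFun ((c : ℂ) * z + u))) ∧
      (∀ x : ℂ, 0 ≤ x.im →
        Tendsto φ (𝓝[upperHalfPlaneSet] x) (𝓝 (F (η * cayleyFun ((c : ℂ) * x + u))))) ∧
      Tendsto φ (cocompact ℂ ⊓ 𝓟 upperHalfPlaneSet) (𝓝 (F η)) := by
  -- the rotated disc map and its extension
  set ψ₂ : ConformalEquiv (ball (0 : ℂ) 1) D.carrier := (rotBall η hη).trans f with hψ₂
  set Ψ₂ : ℂ → ℂ := fun w => F (η * w) with hΨ₂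
  have hrot : MapsTo (fun w : ℂ => η * w) (closedBall 0 1) (closedBall 0 1) := fun w hw => by
    rw [mem_closedBall_zero_iff] at hw ⊢
    rwa [norm_mul, hη, one_mul]
  have hΨ₂c : ContinuousOn Ψ₂ (closedBall 0 1) :=
    hFc.comp (continuous_const_mul η).continuousOn hrot
  set φ' : ConformalEquiv upperHalfPlaneSet D.carrier := cayley.trans ψ₂ with hφ'
  have hΨ₂eq' : EqOn Ψ₂ (cayley.symm.trans φ') (ball 0 1) := fun w hw => by
    have hw' : η * w ∈ ball (0 : ℂ) 1 := (rotBall η hη).mapsTo hw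
    show F (η * w) = φ' (cayley.symm w)
    rw [hFeq hw', hφ', ConformalEquiv.trans_apply, cayley.apply_symm_apply hw]
    rfl
  -- the affine precomposition
  set A : ConformalEquiv upperHalfPlaneSet upperHalfPlaneSet :=
    (ConformalEquiv.smulUpperHalfPlane c hc).trans (addRealUpperHalfPlane u) with hA
  have hAapply : ∀ z : ℂ, A z = (c : ℂ) * z + u := fun z => by
    simp only [hA, ConformalEquiv.trans_apply, ConformalEquiv.smulUpperHalfPlane_apply,
      addRealUpperHalfPlane_apply, Complex.real_smul]
  refine ⟨A.trans φ', fun z _ => ?_, fun x hx => ?_, ?_⟩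
  · simp only [ConformalEquiv.trans_apply, hAapply]
    rfl
  · have hx' : 0 ≤ ((c : ℂ) * x + u).im := by
      simp only [add_im, mul_im, ofReal_re, ofReal_im, zero_mul, add_zero]
      exact mul_nonneg hc.le hx
    have h1 : Tendsto φ' (𝓝[upperHalfPlaneSet] ((c : ℂ) * x + u))
        (𝓝 (Ψ₂ (cayleyFun ((c : ℂ) * x + u)))) :=
      JordanDomain.tendsto_nhdsWithin_of_extension φ' hΨ₂c hΨ₂eq' hx'
    have h2 := h1.comp (tendsto_affine_nhdsWithin hc u x)
    refine h2.congr fun z => ?_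
    simp only [Function.comp_apply, ConformalEquiv.trans_apply, hAapply]
  · have h1 : Tendsto φ' (cocompact ℂ ⊓ 𝓟 upperHalfPlaneSet) (𝓝 (Ψ₂ 1)) :=
      JordanDomain.tendsto_cocompact_of_extension φ' hΨ₂c hΨ₂eq'
    rw [hΨ₂] at h1
    simp only [mul_one] at h1
    have h2 := h1.comp (tendsto_affine_cocompact_inf hc u)
    refine h2.congr fun z => ?_
    simp only [Function.comp_apply, ConformalEquiv.trans_apply, hAapply]

/-- Boundary values and boundary extension of the three-point uniformiser at real points:
`φ̄ x = F (η · cayleyFun (c x + u))` for `im x ≥ 0`. [folklore] -/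
theorem boundaryExtension_threePointMap {D : JordanDomain}
    {φ : ConformalEquiv upperHalfPlaneSet D.carrier} {F : ℂ → ℂ} {η : ℂ} {u c : ℝ}
    (hφ : ∀ x : ℂ, 0 ≤ x.im →
      Tendsto φ (𝓝[upperHalfPlaneSet] x) (𝓝 (F (η * cayleyFun ((c : ℂ) * x + u)))))
    {x : ℂ} (hx : 0 ≤ x.im) :
    φ.boundaryExtension x = F (η * cayleyFun ((c : ℂ) * x + u)) :=
  φ.boundaryExtension_eq_of_hasBoundaryValue (mem_closure_upperHalfPlaneSet_iff.2 hx) (hφ x hx)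

/-! ### The Cayley parametrisation of the unit circle -/

/-- Circle loops turn sums into products: `e^{2πi(s+t)} = e^{2πis} e^{2πit}`. [folklore] -/
theorem circleLoop_add (s t : ℝ) :
    circleLoop 0 1 (s + t) = circleLoop 0 1 s * circleLoop 0 1 t := by
  simp only [circleLoop_apply, zero_add, ofReal_one, one_mul, ofReal_add]
  rw [← Complex.exp_add]
  congr 1
  ring

/-- Equal points of the unit circle loop have parameters differing by an integer. [folklore] -/
theorem exists_int_of_circleLoop_eq {s t : ℝ} (h : circleLoop 0 1 s = circleLoop 0 1 t) :
    ∃ n : ℤ, s = t + n :=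
  JordanDomain.unitDisc.exists_int_of_boundary_eq h

/-- **The Cayley transform on the real line, as a point of the unit circle loop**:
`cayleyFun x = e^{2πi τ(x)}` with `τ(x) = arctan x / π + 1/2` (so `τ` increases from `0` to `1`
as `x` runs from `-∞` to `+∞`: the real line is mapped anticlockwise onto the circle, from `1`
back to `1`). Indeed `-(x - i)/(x + i) = (1 + ix)²/(1 + x²) = e^{2i arctan x}`.
[cite: AhlforsCA1979, Ch. 3 §3] -/
theorem cayleyFun_ofReal_eq_circleLoop (x : ℝ) :
    cayleyFun x = circleLoop 0 1 (Real.arctan x / Real.pi + 1 / 2) := by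
  set θ : ℝ := Real.arctan x with hθ
  have hpi : Real.pi ≠ 0 := Real.pi_ne_zero
  have hsq : 0 < 1 + x ^ 2 := by positivity
  have hs : Real.sqrt (1 + x ^ 2) ^ 2 = 1 + x ^ 2 := Real.sq_sqrt hsq.le
  have hs0 : Real.sqrt (1 + x ^ 2) ≠ 0 := (Real.sqrt_pos.2 hsq).ne'
  have hcos : Real.cos θ = 1 / Real.sqrt (1 + x ^ 2) := Real.cos_arctan x
  have hsin : Real.sin θ = x / Real.sqrt (1 + x ^ 2) := Real.sin_arctan x
  have hc2 : Real.cos (2 * θ) = (1 - x ^ 2) / (1 + x ^ 2) := by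
    rw [Real.cos_two_mul, hcos, div_pow, hs]
    field_simp
    ring
  have hs2 : Real.sin (2 * θ) = 2 * x / (1 + x ^ 2) := by
    rw [Real.sin_two_mul, hsin, hcos]
    field_simp
    rw [hs]
  -- the right-hand side is `-(cos 2θ + i sin 2θ)`
  have hR : circleLoop 0 1 (θ / Real.pi + 1 / 2) =
      -(((1 - x ^ 2) / (1 + x ^ 2) : ℝ) + ((2 * x / (1 + x ^ 2) : ℝ)) * I) := by
    rw [circleLoop_apply, zero_add, ofReal_one, one_mul]
    have e : (2 * (Real.pi : ℂ) * ((θ / Real.pi + 1 / 2 : ℝ) : ℂ) * I) =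
        ((2 * θ : ℝ) : ℂ) * I + Real.pi * I := by
      push_cast
      field_simp
    rw [e, Complex.exp_add, Complex.exp_pi_mul_I, Complex.exp_mul_I, ← Complex.ofReal_cos,
      ← Complex.ofReal_sin, hc2, hs2]
    ring
  rw [hR, cayleyFun_apply]
  have hden : (x : ℂ) + I ≠ 0 := add_I_ne_zero (by simp)
  rw [div_eq_iff hden]
  have h1 : (1 + (x : ℂ) ^ 2) ≠ 0 := by exact_mod_cast hsq.ne'
  push_cast
  field_simp
  ring_nf
  simp only [Complex.I_sq]
  ring

/-- The Cayley parameter `τ(x) = arctan x / π + 1/2` lies in `(0, 1)`. [folklore] -/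
theorem cayleyParam_mem_Ioo (x : ℝ) : Real.arctan x / Real.pi + 1 / 2 ∈ Ioo (0 : ℝ) 1 := by
  have h1 := Real.arctan_lt_pi_div_two x
  have h2 := Real.neg_pi_div_two_lt_arctan x
  have hpi := Real.pi_pos
  constructor
  · have : -(1 / 2 : ℝ) < Real.arctan x / Real.pi := by
      rw [lt_div_iff₀ hpi]; linarith
    linarith
  · have : Real.arctan x / Real.pi < 1 / 2 := by
      rw [div_lt_iff₀ hpi]; linarith
    linarith

/-- The Cayley parameter is strictly increasing. [folklore] -/
theorem cayleyParam_lt_iff {x y : ℝ} :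
    Real.arctan x / Real.pi + 1 / 2 < Real.arctan y / Real.pi + 1 / 2 ↔ x < y := by
  rw [add_lt_add_iff_right, div_lt_div_iff_of_pos_right Real.pi_pos]
  exact Real.arctan_strictMono.lt_iff_lt

/-! ### The sign of the third parameter is minus the index -/

/-- An integer strictly between `0` and `2` (as a real number) is `1`. [folklore] -/
theorem int_eq_one_of_mem_Ioo {n : ℤ} (h0 : (0 : ℝ) < n) (h2 : (n : ℝ) < 2) : n = 1 := by
  have h0' : (0 : ℤ) < n := by exact_mod_cast h0
  have h2' : n < 2 := by exact_mod_cast h2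
  omega

/-- An integer strictly between `-1` and `1` (as a real number) is `0`. [folklore] -/
theorem int_eq_zero_of_mem_Ioo {n : ℤ} (h0 : (-1 : ℝ) < n) (h2 : (n : ℝ) < 1) : n = 0 := by
  have h0' : (-1 : ℤ) < n := by exact_mod_cast h0
  have h2' : n < 1 := by exact_mod_cast h2
  omega

/-- **Orientation of the three-point normalisation.** Let `D` be a Jordan domain with boundary
loop `β`, `0 < t_b < t_c < 1`, `f : 𝔻 → D` conformal with Carathéodory extension `F` (continuous
and injective on `𝔻̄`, circle onto `∂D`), and `ζ_a, ζ_b, ζ_c` the circle preimages of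
`β 0, β t_b, β t_c`. Write `ζ_b⁻¹ ζ_a = cayleyFun u`, `ζ_b⁻¹ ζ_c = cayleyFun u'` with `u, u'`
real. Then `u' < u` if the index of `β` about `D` is `+1`, and `u < u'` if it is `-1`: the
conformal (orientation-preserving) chart `F` carries the anticlockwise circle to the loop `β`
traversed according to its index (`JordanDomain.exists_lift`, `index_eq_mul_index`,
`index_eq_one_of_boundary_eq`), and the real line is the anticlockwise Cayley parametrisation of
the circle (`cayleyFun_ofReal_eq_circleLoop`). Consequently the uniformiser
`(ℍₒ; 0, ∞, s) → (D; β 0, β t_b, β t_c)` has `s = -index`. [folklore] -/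
theorem threePoint_lt_iff (D : JordanDomain) {z₀ : ℂ} (hz₀ : z₀ ∈ D.carrier) {tb tc : ℝ}
    (htb : 0 < tb) (hbc : tb < tc) (htc : tc < 1)
    (f : ConformalEquiv (ball (0 : ℂ) 1) D.carrier) {F : ℂ → ℂ}
    (hFc : ContinuousOn F (closedBall 0 1)) (hFeq : EqOn F f (ball 0 1))
    (hFinj : InjOn F (closedBall 0 1)) (hFsph : BijOn F (sphere 0 1) (frontier D.carrier))
    {ζa ζb ζc : ℂ} (hζa : ζa ∈ sphere (0 : ℂ) 1) (hζb : ζb ∈ sphere (0 : ℂ) 1)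
    (hζc : ζc ∈ sphere (0 : ℂ) 1) (hFa : F ζa = D.boundary 0) (hFb : F ζb = D.boundary tb)
    (hFc' : F ζc = D.boundary tc) {u u' : ℝ} (hu : ζb * cayleyFun u = ζa)
    (hu' : ζb * cayleyFun u' = ζc) :
    (D.index z₀ = 1 → u' < u) ∧ (D.index z₀ = -1 → u < u') := by
  obtain ⟨D₂, hD₂c, hD₂b⟩ := D.exists_ofDiscMap F hFc hFsph
  have hι₂ : D₂.index z₀ = 1 :=
    JordanDomain.index_eq_one_of_boundary_eq D D₂ f hFc hFeq hFinj hD₂c hD₂b hz₀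
  obtain ⟨σ, hσc, hσ, hcase⟩ := JordanDomain.exists_lift D D₂ hD₂c.symm
  have hz₀' : z₀ ∉ frontier D₂.carrier := by
    rw [hD₂c]
    exact fun h => (Set.disjoint_left.1 D.disjoint_carrier_frontier) hz₀ h
  -- the circle preimages are the lifted parameters
  have key : ∀ {t : ℝ}, t ∈ Icc (0 : ℝ) 1 → ∀ {ζ : ℂ}, ζ ∈ sphere (0 : ℂ) 1 →
      F ζ = D.boundary t → ζ = circleLoop 0 1 (σ t) := by
    intro t ht ζ hζ hF
    apply hFsph.injOn hζ (circleLoop_mem_sphere 0 zero_le_one _)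
    rw [hF, ← hσ t ht, hD₂b]
  have h0m : (0 : ℝ) ∈ Icc (0 : ℝ) 1 := ⟨le_rfl, zero_le_one⟩
  have hbm : tb ∈ Icc (0 : ℝ) 1 := ⟨htb.le, (hbc.trans htc).le⟩
  have hcm : tc ∈ Icc (0 : ℝ) 1 := ⟨(htb.trans hbc).le, htc.le⟩
  have h1m : (1 : ℝ) ∈ Icc (0 : ℝ) 1 := ⟨zero_le_one, le_rfl⟩
  have hζa' : ζa = circleLoop 0 1 (σ 0) := key h0m hζa hFa
  have hζb' : ζb = circleLoop 0 1 (σ tb) := key hbm hζb hFb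
  have hζc' : ζc = circleLoop 0 1 (σ tc) := key hcm hζc hFc'
  -- the Cayley parameters and their integer relations
  set τu : ℝ := Real.arctan u / Real.pi + 1 / 2 with hτu
  set τu' : ℝ := Real.arctan u' / Real.pi + 1 / 2 with hτu'
  have hτum : τu ∈ Ioo (0 : ℝ) 1 := cayleyParam_mem_Ioo u
  have hτu'm : τu' ∈ Ioo (0 : ℝ) 1 := cayleyParam_mem_Ioo u'
  have hlt : τu < τu' ↔ u < u' := cayleyParam_lt_iff
  have hlt' : τu' < τu ↔ u' < u := cayleyParam_lt_iff
  obtain ⟨n, hn⟩ : ∃ n : ℤ, σ tb + τu = σ 0 + n := by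
    apply exists_int_of_circleLoop_eq
    rw [circleLoop_add, ← cayleyFun_ofReal_eq_circleLoop, ← hζb', hu, hζa']
  obtain ⟨n', hn'⟩ : ∃ n' : ℤ, σ tb + τu' = σ tc + n' := by
    apply exists_int_of_circleLoop_eq
    rw [circleLoop_add, ← cayleyFun_ofReal_eq_circleLoop, ← hζb', hu', hζc']
  rcases hcase with ⟨hmono, h1⟩ | ⟨hanti, h1⟩
  · -- increasing lift: index `+1`, and `u' < u`
    have hidx : D.index z₀ = 1 := by
      have := JordanDomain.index_eq_mul_index D D₂ hσc hσ (n := 1) (by rw [h1]; simp) hz₀'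
      rw [this, hι₂]; simp
    have h0b : σ 0 < σ tb := hmono h0m hbm htb
    have hbc2 : σ tb < σ tc := hmono hbm hcm hbc
    have hc1 : σ tc < σ 1 := hmono hcm h1m htc
    refine ⟨fun _ => ?_, fun h => ?_⟩
    · have hn1 : n = 1 := int_eq_one_of_mem_Ioo (by linarith [hτum.1]) (by linarith [hτum.2])
      have hn'0 : n' = 0 := int_eq_zero_of_mem_Ioo (by linarith [hτu'm.1]) (by linarith [hτu'm.2])
      rw [hn1] at hn
      rw [hn'0] at hn'
      push_cast at hn hn'
      exact hlt'.1 (by linarith)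
    · rw [hidx] at h; norm_num at h
  · -- decreasing lift: index `-1`, and `u < u'`
    have hidx : D.index z₀ = -1 := by
      have := JordanDomain.index_eq_mul_index D D₂ hσc hσ (n := -1)
        (by rw [h1]; simp [sub_eq_add_neg]) hz₀'
      rw [this, hι₂]; simp
    have h0b : σ tb < σ 0 := hanti h0m hbm htb
    have hbc2 : σ tc < σ tb := hanti hbm hcm hbc
    have hc1 : σ 1 < σ tc := hanti hcm h1m htc
    refine ⟨fun h => ?_, fun _ => ?_⟩
    · rw [hidx] at h; norm_num at h
    · have hn0 : n = 0 := int_eq_zero_of_mem_Ioo (by linarith [hτum.1]) (by linarith [hτum.2])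
      have hn'1 : n' = 1 := int_eq_one_of_mem_Ioo (by linarith [hτu'm.1]) (by linarith [hτu'm.2])
      rw [hn0] at hn
      rw [hn'1] at hn'
      push_cast at hn hn'
      exact hlt.1 (by linarith)

end Summit.CriticalPhenomena.SAWScalingLimit.Theorems.WeldingContinuity

end
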